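import Literature.Claims.NS.ClayPeriodicBlowupCertificate
import Literature.Analysis.FluidPDE.TaoEnstrophyLocalisation
import HarnessLib

/-!
# Clay (D) reference — periodic SUP-NORM blow-up certificates: velocity, gradient or vorticity
# unbounded on `[0, T) × ℝ³` for a periodic classical solution proves printed (D)

Companion to `Literature/Claims/NS/ClayPeriodicBlowupCertificate.lean` (ns-claims-salvage-p5; the
certificate there is Beale–Kato–Majda's time-integral `∫₀ᵀ ‖∇u(t)‖_∞ dt = ∞`) and to the whole-space
certificates of `ClayR3HorizonBridge.lean` (ns-claims-lit-4; there the blow-up must be localised to a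
compact `K ⊆ ℝ³`). On the torus every continuous function is bounded, so for PERIODIC classical
solutions the plain pointwise sup-norm statements most blow-up texts print — «`sup |u(t,·)| → ∞`»,
«`sup |∇u(t,·)| → ∞`», «`sup |ω(t,·)| → ∞` as `t → T*`» — are themselves certificates, with no
time-integrability to check:

* `exists_bounds_of_clayPeriodic_solvable` — if the unforced periodic Cauchy problem `(ν, u₀)`,
  `ν ≥ 0`, is Clay-solvable in the PRINTED class (10) (`u`, `p` smooth on `ℝ³ × [0,∞)`, `u(·,t)`
  periodic, pressure free), then EVERY classical solution `(u, p)` on `ℝ³ × [0, T)` with `u(0) = u₀`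
  and `u(·,t)`, `p(·,t)` periodic has velocity AND velocity gradient bounded on `[0, T) × ℝ³`: the
  Clay solution is boost-normalised to periodic pressure keeping the datum
  (`IsNavierStokesSolution.exists_pressurePeriodic_of_velocityPeriodic_zero`, Tao 2013 L4.1(ii)), both
  are descended to `𝕋³` (`torus_descend_classical_periodic`), they agree on `[0, T)` by uniqueness
  (`torus_velocity_eq_on_Ico`, Majda–Bertozzi Cor. 3.1, any `ν ≥ 0`), and the global one is
  continuous, resp. `C¹`, on the compact `[0, T] × 𝕋³` (`Torus.IsSmoothSpaceTimeOn.exists_norm_le_of_isCompact`,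
  `exists_norm_fderiv_lift_le_of_global`);
* `not_clayPeriodic_solvable_of_velocitySupCertificate` / `…_of_gradientSupCertificate` /
  `…_of_vorticitySupCertificate` — hence a periodic classical solution on `[0, T)` whose velocity /
  gradient / vorticity `curl u` is UNBOUNDED on `[0, T) × ℝ³` (`∀ M, ∃ t ∈ [0,T), ∃ x, M < |·|`)
  excludes printed-(10) solvability of its datum (vorticity via `|curl v| ≤ κ ‖∇v‖`, `norm_curl_le`);
* `navierStokesBreakdownPeriodic_of_velocitySupCertificate` / `…_of_gradientSupCertificate` /
  `…_of_vorticitySupCertificate` — with a smooth divergence-free periodic datum and ONE viscosity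
  `ν > 0`, each certificate proves the leaf `NavierStokesBreakdownPeriodic` (Clay (D) as printed, every
  `ν`, via `navierStokesBreakdownPeriodic_of_not_errataSolvable_zero` and
  `clayPeriodic_solvable_zero_iff_errata`).

Usage on a CARD (§3, axis Δ6/Δ7, periodic NEG rows): a claimed blow-up «`‖u(t)‖_∞ → ∞` (or `‖ω(t)‖_∞ → ∞`)
as `t ↑ T*`» for a classical `ℤ³`-periodic solution (velocity AND pressure periodic on `[0, T*)`) from a
smooth periodic datum composes with `navierStokesBreakdownPeriodic_of_velocitySupCertificate` (resp.
`…vorticitySupCertificate`) — no Δ7 delta; what stays a delta: a pressure that is NOT periodic on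
`[0, T*)` (normalise it first, `IsClassicalNSSolutionOn.exists_pressurePeriodic_of_velocityPeriodic_Ico_zero`,
Δ5), period `L ≠ 1` (rescale first, `ClayPeriodScalingBridge`, Δ1), a datum outside (8)/(11) (Δ4), forcing (Δ3).

## References

* C. L. Fefferman, *Existence and smoothness of the Navier–Stokes equation*, CMI 2006, (B), (D) with
  (8)–(11) p. 2; errata p. 6. [FeffermanClay2006]
* T. Tao, *Localisation and compactness properties of the Navier–Stokes global regularity problem*,
  Anal. PDE 6 (2013): Prop. 1.7, Lemma 4.1 (ii), §2. [Tao2013Localisation]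
* A. J. Majda, A. L. Bertozzi, *Vorticity and Incompressible Flow*, CUP 2002, Cor. 3.1.
  [MajdaBertozziCUP2002]
* J. T. Beale, T. Kato, A. Majda, Comm. Math. Phys. 94 (1984), §1. [BealeKatoMajda1984]

WHAT THIS IS NOT: not a claim about NS regularity or blow-up; not a claim about any author beyond
the typed locator.
-/

open scoped ContDiff ENNReal Topology

namespace Literature.Claims.NS.ClayVariants

open Set Filter MeasureTheory Function Literature.Analysis Literature.Analysis.FluidPDE
  Literature.Analysis.FunctionSpaces

noncomputable section

variable {ν T : ℝ} {u₀ : EuclideanSpace ℝ (Fin 3) → EuclideanSpace ℝ (Fin 3)}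
  {u : ℝ → EuclideanSpace ℝ (Fin 3) → EuclideanSpace ℝ (Fin 3)} {p : ℝ → EuclideanSpace ℝ (Fin 3) → ℝ}

/-- **Printed-(10) Clay solvability bounds every periodic classical solution from the same datum on
its horizon.** Let `ν ≥ 0`, `(u, p)` a classical solution of the unforced system on `ℝ³ × [0, T)` with
`u(0) = u₀` and `u(·,t)`, `p(·,t)` `ℤ³`-periodic for `t ∈ [0,T)`. If `(ν, 0, u₀)` has a solution smooth on
`ℝ³ × [0,∞)` with periodic velocity (class (10)), then `|u|` and `‖∇u‖` are bounded on `[0, T) × ℝ³`: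
boost-normalise the global pressure keeping the datum, descend both solutions to `𝕋³`, identify them
on `[0, T)` by uniqueness, and bound the global one on the compact `[0, T] × 𝕋³`.
[cite: FeffermanClay2006, (B) (D) with (10) (11) p. 2] [cite: MajdaBertozziCUP2002, Cor. 3.1] [cite: Tao2013Localisation, Lemma 4.1 (ii)] -/
theorem exists_bounds_of_clayPeriodic_solvable (hν : 0 ≤ ν)
    (hcl : FluidPDE.IsClassicalNSSolutionOn (Ico 0 T) ν 0 u p) (hu0 : u 0 = u₀)
    (hper : ∀ t ∈ Ico 0 T, IsLatticePeriodic (u t) ∧ IsLatticePeriodic (p t))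
    (hsol : clayPeriodic.Solvable ν 0 u₀) :
    (∃ C : ℝ, ∀ t ∈ Ico 0 T, ∀ x, ‖u t x‖ ≤ C) ∧
      ∃ D : ℝ, ∀ t ∈ Ico 0 T, ∀ x, ‖fderiv ℝ (u t) x‖ ≤ D := by
  obtain ⟨v, q, hvs, hqs, hns, hvper⟩ := hsol
  -- normalise the pressure of the global solution (Galilean boost fixing the datum)
  obtain ⟨w, r, hws, hrs, hnsw, hwper⟩ :=
    hns.exists_pressurePeriodic_of_velocityPeriodic_zero hvs hqs hvper
  have hclw : FluidPDE.IsClassicalNSSolutionOn (Ici 0) ν 0 w r :=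
    (isNavierStokesSolution_and_smooth_iff.1 ⟨hnsw, hws, hrs⟩).1
  -- descend both and compare on the torus
  obtain ⟨hU₁, hlift₁⟩ := torus_descend_classical_periodic hcl hper
  obtain ⟨hU₂, -⟩ := torus_descend_classical_periodic hclw fun t ht => hwper t ht
  have h0 : (fun (t : ℝ) (x : UnitAddTorus (Fin 3)) => u t (Torus.repr x)) 0 =
      (fun (t : ℝ) (x : UnitAddTorus (Fin 3)) => w t (Torus.repr x)) 0 := by
    funext x
    show u 0 (Torus.repr x) = w 0 (Torus.repr x)
    rw [hu0, hnsw.initial]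
  have heq := torus_velocity_eq_on_Ico hν hU₁ hU₂ h0
  refine ⟨?_, ?_⟩
  · -- velocity: continuous on the compact `[0, T] × 𝕋³`
    obtain ⟨C, hC⟩ := hU₂.smooth_velocity.exists_norm_le_of_isCompact isCompact_Icc
      (Icc_subset_Ici_self : Icc (0 : ℝ) T ⊆ Ici 0)
    refine ⟨C, fun s hs y => ?_⟩
    rw [← hlift₁ s hs, heq s hs, Torus.lift_apply]
    exact hC s (Ico_subset_Icc_self hs) _
  · -- gradient: `C¹` on the compact `[0, T] × 𝕋³`
    obtain ⟨D, hD⟩ := exists_norm_fderiv_lift_le_of_global hU₂ T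
    refine ⟨D, fun s hs y => ?_⟩
    rw [← hlift₁ s hs, heq s hs]
    exact hD s (Ico_subset_Icc_self hs) y

/-- **A periodic VELOCITY sup-norm blow-up certificate excludes printed-(10) solvability**: a classical
solution on `ℝ³ × [0, T)`, `u`, `p` periodic, `u(0) = u₀`, with `|u|` unbounded on `[0, T) × ℝ³`
(`∀ M, ∃ t ∈ [0,T), ∃ x, M < |u(t,x)|`) ⇒ `(ν, 0, u₀)` has no solution smooth on `ℝ³ × [0,∞)` with
periodic velocity. [cite: FeffermanClay2006, (D) with (10) (11) p. 2] [cite: MajdaBertozziCUP2002, Cor. 3.1] -/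
theorem not_clayPeriodic_solvable_of_velocitySupCertificate (hν : 0 ≤ ν)
    (hcl : FluidPDE.IsClassicalNSSolutionOn (Ico 0 T) ν 0 u p) (hu0 : u 0 = u₀)
    (hper : ∀ t ∈ Ico 0 T, IsLatticePeriodic (u t) ∧ IsLatticePeriodic (p t))
    (hblow : ∀ M : ℝ, ∃ t ∈ Ico 0 T, ∃ x : EuclideanSpace ℝ (Fin 3), M < ‖u t x‖) :
    ¬ clayPeriodic.Solvable ν 0 u₀ := fun hsol => by
  obtain ⟨⟨C, hC⟩, -⟩ := exists_bounds_of_clayPeriodic_solvable hν hcl hu0 hper hsol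
  obtain ⟨t, ht, x, hM⟩ := hblow C
  exact absurd hM (not_lt.2 (hC t ht x))

/-- **A periodic GRADIENT sup-norm blow-up certificate excludes printed-(10) solvability** (pointwise
form of Beale–Kato–Majda's criterion: `‖∇u‖` unbounded on `[0, T) × ℝ³`).
[cite: FeffermanClay2006, (D) with (10) (11) p. 2] [cite: BealeKatoMajda1984, §1] -/
theorem not_clayPeriodic_solvable_of_gradientSupCertificate (hν : 0 ≤ ν)
    (hcl : FluidPDE.IsClassicalNSSolutionOn (Ico 0 T) ν 0 u p) (hu0 : u 0 = u₀)
    (hper : ∀ t ∈ Ico 0 T, IsLatticePeriodic (u t) ∧ IsLatticePeriodic (p t))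
    (hblow : ∀ M : ℝ, ∃ t ∈ Ico 0 T, ∃ x : EuclideanSpace ℝ (Fin 3), M < ‖fderiv ℝ (u t) x‖) :
    ¬ clayPeriodic.Solvable ν 0 u₀ := fun hsol => by
  obtain ⟨-, D, hD⟩ := exists_bounds_of_clayPeriodic_solvable hν hcl hu0 hper hsol
  obtain ⟨t, ht, x, hM⟩ := hblow D
  exact absurd hM (not_lt.2 (hD t ht x))

/-- **A periodic VORTICITY sup-norm blow-up certificate excludes printed-(10) solvability**
(Beale–Kato–Majda form: `|curl u|` unbounded on `[0, T) × ℝ³`; pointwise `|curl v| ≤ κ ‖∇v‖` with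
`κ = ‖curlCLM‖`, tree lemma `norm_curl_le`). [cite: FeffermanClay2006, (D) with (10) (11) p. 2] [cite: BealeKatoMajda1984, §1] -/
theorem not_clayPeriodic_solvable_of_vorticitySupCertificate (hν : 0 ≤ ν)
    (hcl : FluidPDE.IsClassicalNSSolutionOn (Ico 0 T) ν 0 u p) (hu0 : u 0 = u₀)
    (hper : ∀ t ∈ Ico 0 T, IsLatticePeriodic (u t) ∧ IsLatticePeriodic (p t))
    (hblow : ∀ M : ℝ, ∃ t ∈ Ico 0 T, ∃ x : EuclideanSpace ℝ (Fin 3), M < ‖curl (u t) x‖) :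
    ¬ clayPeriodic.Solvable ν 0 u₀ := by
  refine not_clayPeriodic_solvable_of_gradientSupCertificate hν hcl hu0 hper fun M => ?_
  obtain ⟨t, ht, x, hM⟩ := hblow (‖curlCLM‖ * max M 0)
  refine ⟨t, ht, x, (le_max_left M 0).trans_lt ?_⟩
  exact lt_of_mul_lt_mul_left (hM.trans_le (norm_curl_le (u t) x))
    (ContinuousLinearMap.opNorm_nonneg curlCLM)

/-- **One periodic velocity sup-norm blow-up certificate at one viscosity `ν > 0` proves Clay (D) as
printed** (leaf `NavierStokesBreakdownPeriodic`, every viscosity, via the Δ5/Δ7 bridges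
`clayPeriodic_solvable_zero_iff_errata`, `navierStokesBreakdownPeriodic_of_not_errataSolvable_zero`);
the datum must be smooth, divergence free and `ℤ³`-periodic.
[cite: FeffermanClay2006, (D) p. 2] [cite: Tao2013Localisation, Prop. 1.7 and Rem. 1.2 footnote] -/
theorem navierStokesBreakdownPeriodic_of_velocitySupCertificate (hν : 0 < ν)
    (hu₀ : ContDiff ℝ ∞ u₀) (hdiv : NSWave0.IsDivFree u₀) (hper₀ : IsLatticePeriodic u₀)
    (hcl : FluidPDE.IsClassicalNSSolutionOn (Ico 0 T) ν 0 u p) (hu0 : u 0 = u₀)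
    (hper : ∀ t ∈ Ico 0 T, IsLatticePeriodic (u t) ∧ IsLatticePeriodic (p t))
    (hblow : ∀ M : ℝ, ∃ t ∈ Ico 0 T, ∃ x : EuclideanSpace ℝ (Fin 3), M < ‖u t x‖) :
    Summit.NavierStokesRegularity.NavierStokesRegularity.NavierStokesBreakdownPeriodic :=
  navierStokesBreakdownPeriodic_of_not_errataSolvable_zero hν hu₀ hdiv hper₀ fun h =>
    not_clayPeriodic_solvable_of_velocitySupCertificate hν.le hcl hu0 hper hblow
      ((clayPeriodic_solvable_zero_iff_errata ν u₀).2 h)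

/-- **One periodic gradient sup-norm blow-up certificate at one viscosity `ν > 0` proves Clay (D) as
printed.** [cite: FeffermanClay2006, (D) p. 2] [cite: BealeKatoMajda1984, §1] -/
theorem navierStokesBreakdownPeriodic_of_gradientSupCertificate (hν : 0 < ν)
    (hu₀ : ContDiff ℝ ∞ u₀) (hdiv : NSWave0.IsDivFree u₀) (hper₀ : IsLatticePeriodic u₀)
    (hcl : FluidPDE.IsClassicalNSSolutionOn (Ico 0 T) ν 0 u p) (hu0 : u 0 = u₀)
    (hper : ∀ t ∈ Ico 0 T, IsLatticePeriodic (u t) ∧ IsLatticePeriodic (p t))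
    (hblow : ∀ M : ℝ, ∃ t ∈ Ico 0 T, ∃ x : EuclideanSpace ℝ (Fin 3), M < ‖fderiv ℝ (u t) x‖) :
    Summit.NavierStokesRegularity.NavierStokesRegularity.NavierStokesBreakdownPeriodic :=
  navierStokesBreakdownPeriodic_of_not_errataSolvable_zero hν hu₀ hdiv hper₀ fun h =>
    not_clayPeriodic_solvable_of_gradientSupCertificate hν.le hcl hu0 hper hblow
      ((clayPeriodic_solvable_zero_iff_errata ν u₀).2 h)

/-- **One periodic vorticity sup-norm blow-up certificate at one viscosity `ν > 0` proves Clay (D) as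
printed** (Beale–Kato–Majda form). [cite: FeffermanClay2006, (D) p. 2] [cite: BealeKatoMajda1984, §1] -/
theorem navierStokesBreakdownPeriodic_of_vorticitySupCertificate (hν : 0 < ν)
    (hu₀ : ContDiff ℝ ∞ u₀) (hdiv : NSWave0.IsDivFree u₀) (hper₀ : IsLatticePeriodic u₀)
    (hcl : FluidPDE.IsClassicalNSSolutionOn (Ico 0 T) ν 0 u p) (hu0 : u 0 = u₀)
    (hper : ∀ t ∈ Ico 0 T, IsLatticePeriodic (u t) ∧ IsLatticePeriodic (p t))
    (hblow : ∀ M : ℝ, ∃ t ∈ Ico 0 T, ∃ x : EuclideanSpace ℝ (Fin 3), M < ‖curl (u t) x‖) :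
    Summit.NavierStokesRegularity.NavierStokesRegularity.NavierStokesBreakdownPeriodic :=
  navierStokesBreakdownPeriodic_of_not_errataSolvable_zero hν hu₀ hdiv hper₀ fun h =>
    not_clayPeriodic_solvable_of_vorticitySupCertificate hν.le hcl hu0 hper hblow
      ((clayPeriodic_solvable_zero_iff_errata ν u₀).2 h)

end

end Literature.Claims.NS.ClayVariants

-- WHAT THIS IS NOT: not a claim about NS regularity or blow-up; not a claim about any author beyond the typed locator.
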